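import Literature.Computability.QuantumComplexity.PolyCopies
import HarnessLib

/-!
# Polynomially many parallel copies, V: "at least one copy succeeds"

Topic `Literature/Computability/QuantumComplexity`; a sequel of `PolyCopies.lean` (the uniform family
running `K(n) = pK(n) + 1` copies of a uniform family `F` on disjoint blocks, with the product
output law `kernelProb_family_eq` / `sum_normSq_prodState_mul`). `PolyCopies.lean` reads the copies
out by a *majority vote* (Bennett–Bernstein–Brassard–Vazirani 1997, Thm. 4.13). For *search*
problems whose candidate solutions can be recognised or ranked classically one instead repeats and
keeps the best candidate: if one run succeeds with probability `q`, then `K` independent runs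
contain a successful one with probability `1 − (1 − q)^K` (e.g. Regev 2004, proof of Thm. 1.1,
p. 7: "With each of these values the SVP algorithm calls the algorithm of Lemma 3.4 a polynomial
number of times. With high probability in one of these calls the algorithm returns the vector …
The results of the other calls can be easily discarded"; Nielsen–Chuang 2010, §4.5.2 and Box 5.4
on repetition). This file proves that bound for the `K(n)`-copy family:

* `sum_ite_blockState_eq_kernelProb` — the one-block marginal of a read-out event of the copy is
  the kernel probability of `F` for that event;
* **`kernelProb_ge_of_exists`** — if the event `E` on the measured string of the `K(n)`-copy family
  contains every string in which *some* block's read-out lies in `GB`, then the family outputs a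
  string in `E` with probability at least `1 − (1 − F.kernelProb x GB)^{K(n)}`;
* `kernelProb_ge_of_exists'` — the monotone form with a lower bound
  `q ≤ F.kernelProb x GB`.

No named fact is introduced.

## References

* O. Regev, *Quantum computation and lattice problems*, SIAM J. Comput. 33 (2004) 738–760,
  proof of Thm. 1.1 from Lemma 3.4 (p. 7) [Regev2004].
* M. A. Nielsen, I. L. Chuang, *Quantum Computation and Quantum Information*, CUP 2010, §2.2.8
  (measurement statistics of product states), §4.5.2 [NielsenChuang2010].
* C. H. Bennett, E. Bernstein, G. Brassard, U. Vazirani, SIAM J. Comput. 26 (1997), Thm. 4.13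
  [BennettBernsteinBrassardVazirani1997].
-/

noncomputable section

namespace Literature.Computability.QuantumComplexity

namespace PolyCopies

open _root_.Computability Complexity Cryptography Function Matrix Finset

variable {P : Params}

/-- **The one-block marginal of a read-out event of the copy is the kernel probability of `F`.**
For an event `GB` on the measured string of `F` (of length `n + F.ancillas n`), the Born weight of
the block contents whose copy part reads in `GB` equals `F.kernelProb 0 x GB`.
[cite: NielsenChuang2010, §2.2.8 (measurement of one register of a product state)] -/
theorem sum_ite_blockState_eq_kernelProb (x : List Bool) (GB : Set (List Bool)) [DecidablePred (· ∈ GB)] :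
    (∑ v : QReg (b P x.length),
        if List.ofFn (v ∘ Fin.castLEEmb (copy_fits x.length)) ∈ GB then ‖blockState P x v‖ ^ 2 else 0) =
      P.F.kernelProb 0 x GB := by
  classical
  simp only [blockState, Cpad, toMatrix_mapWires]
  rw [sum_normSq_placeGate_castLE (copy_fits x.length) ((P.F.circ x.length).toMatrix 0) (padBlock P x)
    (fun u : QReg (x.length + P.F.ancillas x.length) => List.ofFn u ∈ GB), padBlock_comp_castLE]
  change _ = ((((P.F.circ x.length).outputPMF 0 x.get).map List.ofFn).toOuterMeasure GB).toReal
  rw [toReal_outputPMF_map_ofFn]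
  refine Finset.sum_congr rfl fun u _ => ?_
  simp only [QCircuit.runOn, mulVec_basisState]

/-- **"At least one copy succeeds."** If `E` contains every measured string of the `K(n)`-copy
family in which the copy part of some block lies in `GB`, then the family outputs a string in `E`
with probability at least `1 − (1 − F.kernelProb 0 x GB)^{K(n)}`: by the product law the blocks
are independent with the one-block marginal `F.kernelProb 0 x GB`, and all of them fail with
probability `(1 − F.kernelProb 0 x GB)^{K(n)}`. [cite: Regev2004, Thm. 1.1 (proof from Lemma 3.4, p. 7: polynomially many calls, keep the good one)] -/
theorem kernelProb_ge_of_exists (x : List Bool) (GB : Set (List Bool)) [DecidablePred (· ∈ GB)]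
    (E : Set (List Bool)) [DecidablePred (· ∈ E)]
    (hE : ∀ z : QReg (x.length + anc P x.length),
      (∃ j : Fin (K P x.length),
        List.ofFn (z ∘ blockEmb P x.length j ∘ Fin.castLEEmb (copy_fits x.length)) ∈ GB) → List.ofFn z ∈ E) :
    1 - (1 - P.F.kernelProb 0 x GB) ^ K P x.length ≤ (family P).kernelProb 0 x E := by
  classical
  rw [kernelProb_family_eq]
  set w : QReg (b P x.length) → ℝ := fun v => ‖blockState P x v‖ ^ 2 with hw
  set good : QReg (b P x.length) → Prop := fun v => List.ofFn (v ∘ Fin.castLEEmb (copy_fits x.length)) ∈ GB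
    with hgooddef
  set fail : (Fin (K P x.length) → QReg (b P x.length)) → Prop := fun y => ∀ j, ¬ good (y j) with hfail
  have hw0 : ∀ v, 0 ≤ w v := fun v => by positivity
  have hw1 : ∑ v, w v = 1 := sum_normSq_blockState x
  -- the one-block marginals
  have hq : (∑ v, if good v then w v else 0) = P.F.kernelProb 0 x GB := sum_ite_blockState_eq_kernelProb x GB
  have hq' : (∑ v, if good v then 0 else w v) = 1 - P.F.kernelProb 0 x GB := by
    rw [← hq, ← hw1, eq_sub_iff_add_eq]
    rw [← Finset.sum_add_distrib]
    exact Finset.sum_congr rfl fun v _ => by split_ifs <;> simp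
  -- all blocks fail with probability `(1 - q)^K`
  have hfailSum : (∑ y : Fin (K P x.length) → QReg (b P x.length), if fail y then ∏ j, w (y j) else 0) =
      (1 - P.F.kernelProb 0 x GB) ^ K P x.length := by
    have e := Finset.prod_univ_sum (fun _ : Fin (K P x.length) => (univ : Finset (QReg (b P x.length))))
      (fun _ v => if good v then (0 : ℝ) else w v)
    simp only [Fintype.piFinset_univ] at e
    rw [hq', Finset.prod_const, Finset.card_univ, Fintype.card_fin] at e
    rw [e]
    refine Finset.sum_congr rfl fun y _ => ?_
    by_cases hf : fail y
    · rw [if_pos hf]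
      exact Finset.prod_congr rfl fun j _ => by rw [if_neg (hf j)]
    · rw [if_neg hf]
      obtain ⟨j, hj⟩ : ∃ j, good (y j) := by
        by_contra h
        exact hf fun j hj => h ⟨j, hj⟩
      exact (Finset.prod_eq_zero (Finset.mem_univ j) (by rw [if_pos hj])).symm
  have htot : (∑ y : Fin (K P x.length) → QReg (b P x.length), ∏ j, w (y j)) = 1 := by
    have e := Finset.prod_univ_sum (fun _ : Fin (K P x.length) => (univ : Finset (QReg (b P x.length)))) (fun _ v => w v)
    simp only [Fintype.piFinset_univ] at e
    rw [← e, hw1, Finset.prod_const_one]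
  have hterm : ∀ z : QReg (x.length + anc P x.length),
      ‖prodState (blockEmb P x.length) (fun _ => blockState P x) (W1 P x) z‖ ^ 2 *
          (1 - if fail (fun j => z ∘ blockEmb P x.length j) then 1 else 0) ≤
        (if List.ofFn z ∈ E then ‖prodState (blockEmb P x.length) (fun _ => blockState P x) (W1 P x) z‖ ^ 2 else 0) := by
    intro z
    by_cases hf : fail (fun j => z ∘ blockEmb P x.length j)
    · rw [if_pos hf, sub_self, mul_zero]
      split_ifs <;> positivity
    · rw [if_neg hf, sub_zero, mul_one, if_pos]
      refine hE z ?_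
      obtain ⟨j, hj⟩ : ∃ j, good (z ∘ blockEmb P x.length j) := by
        by_contra h
        exact hf fun j hj => h ⟨j, hj⟩
      exact ⟨j, hj⟩
  calc 1 - (1 - P.F.kernelProb 0 x GB) ^ K P x.length
      = 1 - ∑ y : Fin (K P x.length) → QReg (b P x.length), if fail y then ∏ j, w (y j) else 0 := by rw [hfailSum]
    _ = ∑ y : Fin (K P x.length) → QReg (b P x.length), (∏ j, w (y j)) * (1 - if fail y then 1 else 0) := by
        have e : ∀ y : Fin (K P x.length) → QReg (b P x.length), (∏ j, w (y j)) * (1 - if fail y then 1 else 0) =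
            (∏ j, w (y j)) - (if fail y then ∏ j, w (y j) else 0) := fun y => by
          split_ifs <;> ring
        simp only [e, Finset.sum_sub_distrib, htot]
    _ = ∑ z : QReg (x.length + anc P x.length),
          ‖prodState (blockEmb P x.length) (fun _ => blockState P x) (W1 P x) z‖ ^ 2 *
            (1 - if fail (fun j => z ∘ blockEmb P x.length j) then 1 else 0) :=
        (sum_normSq_prodState_mul blockDisjoint (fun _ => blockState P x) (W1 P x) (fun y => 1 - if fail y then 1 else 0)).symm
    _ ≤ _ := Finset.sum_le_sum fun z _ => hterm z

/-- `1 − (1 − q)^K ≥ 1 − exp(−qK)`: the standard estimate turning `K ≥ (ln 3)/q` repetitions into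
success probability `≥ 2/3`. [folklore] -/
theorem one_sub_exp_le_one_sub_pow {q : ℝ} (hq1 : q ≤ 1) (K : ℕ) :
    1 - Real.exp (-(q * K)) ≤ 1 - (1 - q) ^ K := by
  have h1 : (1 - q) ^ K ≤ Real.exp (-(q * K)) := by
    calc (1 - q) ^ K ≤ (Real.exp (-q)) ^ K := by
          refine pow_le_pow_left₀ (by linarith) ?_ K
          have := Real.add_one_le_exp (-q); linarith
      _ = Real.exp (-(q * K)) := by rw [← Real.exp_nat_mul]; ring_nf
  linarith

/-- **"At least one copy succeeds", monotone form.** With a lower bound `q ≤ F.kernelProb 0 x GB`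
the `K(n)`-copy family outputs a string in `E` with probability at least
`1 − (1 − q)^{K(n)} ≥ 1 − e^{−q K(n)}`. [cite: Regev2004, Thm. 1.1 (proof from Lemma 3.4, p. 7)] -/
theorem kernelProb_ge_of_exists' (x : List Bool) (GB : Set (List Bool)) [DecidablePred (· ∈ GB)]
    (E : Set (List Bool)) [DecidablePred (· ∈ E)]
    (hE : ∀ z : QReg (x.length + anc P x.length),
      (∃ j : Fin (K P x.length),
        List.ofFn (z ∘ blockEmb P x.length j ∘ Fin.castLEEmb (copy_fits x.length)) ∈ GB) → List.ofFn z ∈ E)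
    {q : ℝ} (hqF : q ≤ P.F.kernelProb 0 x GB) :
    1 - Real.exp (-(q * K P x.length)) ≤ (family P).kernelProb 0 x E := by
  have h1 := P.F.kernelProb_le_one 0 x GB
  -- monotonicity of `q ↦ 1 − (1 − q)^K` on `[0, 1]` (cf. `orLayer_mono`, `ReadOnceAmplification.lean`)
  have hmono : 1 - (1 - q) ^ K P x.length ≤ 1 - (1 - P.F.kernelProb 0 x GB) ^ K P x.length := by
    have := pow_le_pow_left₀ (by linarith) (by linarith : 1 - P.F.kernelProb 0 x GB ≤ 1 - q) (K P x.length)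
    linarith
  exact (one_sub_exp_le_one_sub_pow (hqF.trans h1) _).trans (hmono.trans (kernelProb_ge_of_exists x GB E hE))

end PolyCopies

end Literature.Computability.QuantumComplexity

end
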